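import Summits.BirchSwinnertonDyer.BirchSwinnertonDyer.Theorems.ByReductionTypeAtTwoOrdKatoHalfAtTwoIsoZetaColemanMuSignFreeSupply
import Literature.NumberTheory.EllipticCurves.FineSelmerTorsionCoefficientsFiniteProofs
import Literature.NumberTheory.EllipticCurves.Kato2004.LocalIwasawaCohomology
import Literature.NumberTheory.EllipticCurves.HeegnerPointsKolyvaginCebotarevProofs
import HarnessLib

/-!
# Route ByReductionTypeAtTwo, crux `OrdKatoHalfAtTwoIso` (stmt-BirchSwinnertonDyer-19573), line
# `steinberg-fibre-at-two`, child F1μ⁺ `OrdKatoFineZetaAtTwoResidue` (stmt-BirchSwinnertonDyer-23959): the localisation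
# `φ = loc₂` of the Selmer-side doors may be THE restriction to ONE decomposition group above `2` — over the cyclotomic
# `ℤ₂`-extension of `ℚ` the prime `2` is undecomposed, so «`res_{D₂} s = 0`» is already «`res_{D} (conj_σ s) = 0` for
# every decomposition group `D` above `2` and every `σ`» (KERNEL), and the doors are restated with that one-place kernel

Seat `cruxlead-stmt-BirchSwinnertonDyer-19573-w3` g2 (prover WIDTH under the LEAD `cruxlead-19573` g5; HOME
`run/shared/lean/pub/bsd-2adic/`; `--supports` stmt-BirchSwinnertonDyer-23959). HONEST FRAMING (cell bsd-2adic): BSD is not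
proved by any of this; F1μ⁺ and the crux are NOT proved here; kernel lemmas and door restatements only — no definition,
no named fact, no `sorry`.

WHY THIS FILE. The doors p686000/`…SignFreeSupply` take `φ : Sel_{2^∞}(E/ℚ_∞) → S` with the kernel hypothesis
`hφker : φ s = 0 ↔ ∀ v ∋ 2, ∀ σ ∈ Γ_ℚ, conj_σ s ∈ awayKer v` («`s` restricts to `0` on `Gal(ℚ̄/ℚ_∞) ⊓ D` for EVERY
decomposition group `D` above `2`»). The supplier's `φ` is the localisation at ONE place — the restriction
`H¹(ker κ, E[2^∞]) → H¹(ker κ ⊓ D_v, E[2^∞])` for the tree's chosen `D_v = decomp v`, `v = (2)`, or its model through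
`Γ_{ℚ₂}` — whose kernel is «`res_{ker κ ⊓ D_v} s = 0`» at that one `D_v`. The two agree because `ℚ_∞/ℚ` has ONE
prime above `2`: `κ(D_v) = ℤ₂` (`Kato2004.surjective_comp_resGalOfEmb_of_isCyclotomic`, from the tree's
`ZpExtension.IsCyclotomic.exists_apply_resGalOfEmb_adicCompletion_eq`), so every `σ ∈ Γ_ℚ` is `δ·h` with `δ ∈ D_v`,
`h ∈ ker κ`; `conj_h = id` on `H¹(ker κ, ·)` (`conjH1_of_mem_holds`) and `res_{ker κ ⊓ D_v} ∘ conj_δ` vanishes where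
`res_{ker κ ⊓ D_v}` does (`FineSelmerCoefficientMap.resOfLe_conjH1_eq_zero_of_mem`, `δ` normalises `ker κ ⊓ D_v`).

* §1 `resOfLe_conjH1_eq_zero_of_forall_exists_mem_decomp` — for ANY number field `K`, `ℤ_p`-extension `κ`, discrete
  module `M` and finite place `v` with `κ(D_v) = ℤ_p` (one place of `K_∞` above `v`): `res_{ker κ ⊓ D_v} x = 0 ⇒
  res_{ker κ ⊓ D_v} (conj_σ x) = 0` for every `σ`; §1′ the instance `K = ℚ`, `κ` cyclotomic, `v ∣ p`
  (`resOfLe_conjH1_eq_zero_of_isCyclotomic_rat`), any `p`.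
* §2 `hφker_of_kernel_at_one_place_two` — at `p = 2`: a `φ` on `Sel_{2^∞}(E/ℚ_∞)` with `φ s = 0 ↔ res_{ker κ ⊓ D_{v₂}} s = 0`
  for ONE `v₂ ∋ 2` satisfies the doors' `hφker` (places of `ℚ` above `2` coincide: `HeightOneSpectrum.eq_of_natCast_mem_rat`).
* §3 the doors with the ONE-PLACE kernel: `hasZetaColemanMuInputsAtTwo_of_localDualPair_locOne_erl` (per datum),
  `mu_eq_zero_of_localDualPair_finiteKer_locOne_erl` (`μ = 0`, finite-kernel `col`, `Δ < 0`), and the ∀-supply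
  `zetaColemanMuInputsAtTwo_of_localDualPairs_locOne_erl` / `ordKatoFineZetaAtTwoResidue_of_localDualPairs_locOne_erl`
  concluding child 23959's text BY NAME. After this file the Selmer-facing half of (L) asks of the supplier only: an
  abelian group `S` with `ψ`, a map `φ : Sel → S` intertwining `conj_γ − 1` with `ψ` whose kernel is the kernel of THE
  restriction to `ker κ ⊓ D_{(2)}` — e.g. `φ` = that restriction followed by any injection.

References: [GreenbergLNM1716] §2 (p. 72: the primes of `F_∞` above `p`; Prop. 2.1); [Washington1997] §13.1, Prop. 13.2
(`ℚ_∞/ℚ` totally ramified at `p`); [SerreLocalFields1979] VII §5 Prop. 3 (inner automorphisms act trivially);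
[Kato2004Asterisque] (14.9.3), §17.13; tree p682177, p686000, `…SignFreeSupply` (w3 g2),
`FineSelmerTorsionCoefficientsFiniteProofs.lean` §2 (the `δ·τ_i·h` device, LimSujatha2018 §3).
-/

set_option autoImplicit false
set_option linter.dupNamespace false

noncomputable section

open scoped Classical MatrixGroups ModularForm NumberField
open CongruenceSubgroup WeierstrassCurve Field IsDedekindDomain NumberField
open Literature.NumberTheory.GaloisRepresentations
open Literature.NumberTheory.EllipticCurves Literature.NumberTheory.EllipticCurves.ModularForms
  Literature.NumberTheory.EllipticCurves.GreenbergSelmer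
  Literature.NumberTheory.EllipticCurves.FineSelmerCoefficientMap
open Literature.NumberTheory.EllipticCurves.Kato2004
  Literature.NumberTheory.EllipticCurves.Kato2004.EulerSystemValues
open Literature.NumberTheory.EllipticCurves.IwasawaDual
open Literature.NumberTheory.EllipticCurves.Rank1Residual
open Summit.BirchSwinnertonDyer.Rank1Residual Summit.BirchSwinnertonDyer.Rank1Residual.X5
open Summit.BirchSwinnertonDyer.BirchSwinnertonDyer.Theses.ByReductionTypeAtTwo

namespace Summit.BirchSwinnertonDyer.BirchSwinnertonDyer.Theorems.SteinbergFibreAtTwo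

/-! ## §1 One place above `v`: local triviality at `D_v` is stable under `conj_σ` -/

section OnePlace

variable {K : Type} [Field K] [NumberField K] {p : ℕ} [Fact p.Prime] (κ : ZpExtension K p)
  {M : Type} [AddCommGroup M] [DistribMulAction (absoluteGaloisGroup K) M] [TopologicalSpace M]
  [DiscreteTopology M]

/-- **One place of `K_∞` above `v` ⇒ the local condition at `D_v` is `Γ_K`-stable.** If `κ` maps the decomposition
group `D_v` ONTO `ℤ_p` (the place `v` is undecomposed in `K_∞/K`), then for every class `x ∈ H¹(ker κ, M)` with
`res_{ker κ ⊓ D_v} x = 0` and every `σ ∈ Γ_K` also `res_{ker κ ⊓ D_v} (conj_σ x) = 0`: write `σ = δ·h` with `δ ∈ D_v`,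
`κ h = 1`; `conj_h` is the identity on `H¹(ker κ, M)` (inner automorphism) and `res_{ker κ ⊓ D_v} ∘ conj_δ` kills what
`res_{ker κ ⊓ D_v}` kills (`δ` normalises `ker κ ⊓ D_v`). In print: the local conditions at the `Γ`-conjugates of the
chosen prime above `v` are all the same condition when there is only one such prime.
[cite: GreenbergLNM1716, §2 (p. 72)] [cite: SerreLocalFields1979, VII §5 Prop. 3] -/
theorem resOfLe_conjH1_eq_zero_of_forall_exists_mem_decomp (v : HeightOneSpectrum (𝓞 K))
    (hD : ∀ t : Multiplicative ℤ_[p], ∃ δ ∈ decomp v, κ δ = t)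
    {x : subgroupH1 κ.kerSubgroup M}
    (hx : resOfLe M (inf_le_left : κ.kerSubgroup ⊓ decomp v ≤ κ.kerSubgroup) x = 0)
    (σ : absoluteGaloisGroup K) :
    resOfLe M (inf_le_left : κ.kerSubgroup ⊓ decomp v ≤ κ.kerSubgroup) (conjH1 κ.kerSubgroup M σ x) = 0 := by
  obtain ⟨δ, hδD, hδ⟩ := hD (κ σ)
  -- `h = δ⁻¹ σ ∈ ker κ`
  have hh : δ⁻¹ * σ ∈ κ.kerSubgroup := by
    rw [ZpExtension.mem_kerSubgroup, map_mul, map_inv, hδ, inv_mul_cancel]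
  have hσ : σ = δ * (δ⁻¹ * σ) := by group
  rw [hσ, Literature.NumberTheory.EllipticCurves.conjH1_mul_holds, AddMonoidHom.comp_apply,
    Literature.NumberTheory.EllipticCurves.conjH1_of_mem_holds κ.kerSubgroup M hh, AddMonoidHom.id_apply]
  exact resOfLe_conjH1_eq_zero_of_mem κ.kerSubgroup (decomp v) hδD hx

end OnePlace

section Rat

variable {p : ℕ} [Fact p.Prime] {κ : ZpExtension ℚ p}
  {M : Type} [AddCommGroup M] [DistribMulAction (absoluteGaloisGroup ℚ) M] [TopologicalSpace M]
  [DiscreteTopology M]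

/-- For the CYCLOTOMIC `ℤ_p`-extension of `ℚ` and `v ∣ p`, `κ(D_v) = ℤ_p` — `ℚ_∞/ℚ` is totally ramified at `p`
(the tree's `Kato2004.surjective_comp_resGalOfEmb_of_isCyclotomic`; `decomp v` is the image of `Γ_{ℚ_v}`).
[cite: Washington1997, §13.1 Prop. 13.2] -/
theorem forall_exists_mem_decomp_of_isCyclotomic_rat (hκ : κ.IsCyclotomic) (v : HeightOneSpectrum (𝓞 ℚ))
    (hv : (p : 𝓞 ℚ) ∈ v.asIdeal) : ∀ t : Multiplicative ℤ_[p], ∃ δ ∈ decomp v, κ δ = t := by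
  intro t
  obtain ⟨σv, hσv⟩ := surjective_comp_resGalOfEmb_of_isCyclotomic (κ := κ) (v := v) hκ hv t
  exact ⟨resGalOfEmb (closureEmb (K := ℚ) (v.adicCompletion ℚ)) σv, (mem_decomp_iff v _).2 ⟨σv, rfl⟩, hσv⟩

/-- **`ℚ`, cyclotomic `κ`, `v ∣ p`: local triviality at `ker κ ⊓ D_v` is `Γ_ℚ`-stable** (§1 with `κ(D_v) = ℤ_p`).
[cite: GreenbergLNM1716, §2 (p. 72)] [cite: Washington1997, §13.1 Prop. 13.2] -/
theorem resOfLe_conjH1_eq_zero_of_isCyclotomic_rat (hκ : κ.IsCyclotomic) (v : HeightOneSpectrum (𝓞 ℚ))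
    (hv : (p : 𝓞 ℚ) ∈ v.asIdeal) {x : subgroupH1 κ.kerSubgroup M}
    (hx : resOfLe M (inf_le_left : κ.kerSubgroup ⊓ decomp v ≤ κ.kerSubgroup) x = 0)
    (σ : absoluteGaloisGroup ℚ) :
    resOfLe M (inf_le_left : κ.kerSubgroup ⊓ decomp v ≤ κ.kerSubgroup) (conjH1 κ.kerSubgroup M σ x) = 0 :=
  resOfLe_conjH1_eq_zero_of_forall_exists_mem_decomp κ v (forall_exists_mem_decomp_of_isCyclotomic_rat hκ v hv)
    hx σ

end Rat

/-! ## §2 At `p = 2`: the one-place kernel gives the doors' `hφker` -/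

section Two

variable {W : WeierstrassCurve ℚ} {κ : ZpExtension ℚ 2}

/-- **The doors' kernel hypothesis from ONE place.** For the cyclotomic `ℤ₂`-extension `κ` of `ℚ`, a place `v₂ ∋ 2` and a
map `φ` on `Sel_{2^∞}(E/ℚ_∞)` whose kernel is «`res_{ker κ ⊓ D_{v₂}} s = 0`», one has
`φ s = 0 ↔ ∀ v ∋ 2, ∀ σ, conj_σ s ∈ awayKer v`: the places of `ℚ` containing `2` coincide with `v₂`
(`HeightOneSpectrum.eq_of_natCast_mem_rat`) and the condition at `D_{v₂}` is `conj`-stable (§1); conversely take `σ = 1`.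
[cite: GreenbergLNM1716, §2 (p. 72) and Prop. 2.1] [cite: Washington1997, §13.1 Prop. 13.2] -/
theorem hφker_of_kernel_at_one_place_two (hκ : κ.IsCyclotomic) (v₂ : HeightOneSpectrum (𝓞 ℚ))
    (hv₂ : ((2 : ℕ) : 𝓞 ℚ) ∈ v₂.asIdeal) {S : Type*} [AddCommGroup S] (φ : W.selmerInfty κ →+ S)
    (hφ₁ : ∀ s : W.selmerInfty κ, φ s = 0 ↔
      W.resOfLe 2 (inf_le_left : κ.kerSubgroup ⊓ decomp v₂ ≤ κ.kerSubgroup)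
        (s : W.subgroupH1 2 κ.kerSubgroup) = 0) :
    ∀ s : W.selmerInfty κ, φ s = 0 ↔
      ∀ (v : HeightOneSpectrum (𝓞 ℚ)), ((2 : ℕ) : 𝓞 ℚ) ∈ v.asIdeal → ∀ σ : absoluteGaloisGroup ℚ,
        W.conjH1 2 κ.kerSubgroup σ (s : W.subgroupH1 2 κ.kerSubgroup) ∈
          awayKer κ.kerSubgroup (W.geomPrimaryTorsion 2) v := by
  intro s
  rw [hφ₁ s]
  constructor
  · intro hs v hv σ
    obtain rfl : v = v₂ := HeightOneSpectrum.eq_of_natCast_mem_rat Nat.prime_two hv hv₂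
    exact resOfLe_conjH1_eq_zero_of_isCyclotomic_rat (M := W.geomPrimaryTorsion 2) hκ v hv hs σ
  · intro hs
    have h := hs v₂ hv₂ 1
    rwa [W.conjH1_one_holds 2 κ.kerSubgroup, AddMonoidHom.id_apply] at h

end Two

/-! ## §3 The doors with the ONE-PLACE kernel -/

section PerDatum

variable {W : WeierstrassCurve ℚ} [W.IsElliptic] [W.IsGloballyMinimal]
  [ContinuousSMul ℤ_[2] (W.tateModule 2)] [Module.Free ℤ_[2] (W.tateModule 2)]
  [Module.Finite ℤ_[2] (W.tateModule 2)] {N : ℕ} {f : CuspForm (Gamma0 N) 2}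
  {κ : ZpExtension ℚ 2} {γ : absoluteGaloisGroup ℚ} {hκ : κ.IsCyclotomic}

/-- **The per-datum reading from the three typed inputs, `φ` given by its kernel at ONE place above `2`**
(`hasZetaColemanMuInputsAtTwo_of_localDualPair_locTwo_erl` + `hφker_of_kernel_at_one_place_two`; `κ` cyclotomic is
already a binder of the reading). Kernel; nothing asserted.
[cite: Kato2004Asterisque, (14.9.3) (p. 240), Thm 16.6 (2) (p. 271), Prop 17.11 (p. 277), §17.13 (pp. 279–280)]
[cite: GreenbergLNM1716, §2 (p. 72) and Prop. 2.1] -/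
theorem hasZetaColemanMuInputsAtTwo_of_localDualPair_locOne_erl (D : W.SelmerDualData κ γ)
    (Y : W.FineSelmerDualData κ γ) (I : IwasawaH1Data W 2 κ γ) (G : Set I.H)
    (hG : ∀ g ∈ G, IsEulerSystemClassTwo W hκ I g)
    (v₂ : HeightOneSpectrum (𝓞 ℚ)) (hv₂ : ((2 : ℕ) : 𝓞 ℚ) ∈ v₂.asIdeal)
    {P₀ : Type*} [AddCommGroup P₀] [Module (IwasawaAlgebra 2) P₀] {S : Type*} [AddCommGroup S]
    {ψ : AddMonoid.End S} {toDualP : P₀ →+ (S →+ AddCircle (1 : ℚ))} (hP : IsDualPair 2 ψ toDualP)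
    (col : P₀ →ₗ[IwasawaAlgebra 2] IwasawaAlgebra 2) (hcol : Function.Injective col)
    (φ : W.selmerInfty κ →+ S) (hφ : ∀ s, φ ((W.conjSelmerInfty κ γ - 1) s) = ψ (φ s))
    (hφ₁ : ∀ s : W.selmerInfty κ, φ s = 0 ↔
      W.resOfLe 2 (inf_le_left : κ.kerSubgroup ⊓ decomp v₂ ≤ κ.kerSubgroup)
        (s : W.subgroupH1 2 κ.kerSubgroup) = 0)
    (ℓ₀ : I.H →ₗ[IwasawaAlgebra 2] P₀)
    (hrecG : ∀ g ∈ G, ∀ s : W.selmerInfty κ, toDualP (ℓ₀ g) (φ s) = 0)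
    (herl : ∃ g ∈ G, ∃ (u : (IwasawaAlgebra 2)ˣ) (M L' : IwasawaAlgebra 2) (r : ℚ_[2]),
      M ∉ IwasawaAlgebra.augIdealP 2 ∧ ‖r‖ = 1 ∧
        iwasawaToPowerSeries 2 L' = PowerSeries.C r * padicLFunction f (unitRoot W 2 : ℚ_[2]) ∧
        col (ℓ₀ g) = (u : IwasawaAlgebra 2) * M * L') :
    HasZetaColemanMuInputsAtTwo W f κ γ hκ D Y :=
  hasZetaColemanMuInputsAtTwo_of_localDualPair_locTwo_erl D Y I G hG hP col hcol φ hφ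
    (hφker_of_kernel_at_one_place_two hκ v₂ hv₂ φ hφ₁) ℓ₀ hrecG herl

/-- **`μ(X(E/ℚ_∞)) = 0` from the three typed inputs with a FINITE-KERNEL `col`, `φ` given by its kernel at ONE place
above `2`**, for `W` good ordinary at `2`, `ρ̄₂` onto, `Δ_W < 0`, any Selmer dual datum `D`. Kernel.
[cite: Kato2004Asterisque, Thm 16.6 (2) (p. 271), Prop 17.11 (p. 277), §17.13 (pp. 279–280)] [cite: GreenbergLNM1716, §2 (p. 72)] -/
theorem mu_eq_zero_of_localDualPair_finiteKer_locOne_erl [NeZero N] (hgo : GoodOrd W 2)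
    (h2 : W.HasSurjectiveModNGaloisRep 2) (hΔ : W.Δ < 0) (hf : IsNewformOf W f) (hγ : κ.IsTopGenerator γ)
    (D : W.SelmerDualData κ γ) (I : IwasawaH1Data W 2 κ γ) (G : Set I.H)
    (hG : ∀ g ∈ G, IsEulerSystemClassTwo W hκ I g)
    (v₂ : HeightOneSpectrum (𝓞 ℚ)) (hv₂ : ((2 : ℕ) : 𝓞 ℚ) ∈ v₂.asIdeal)
    {P₀ : Type*} [AddCommGroup P₀] [Module (IwasawaAlgebra 2) P₀] {S : Type*} [AddCommGroup S]
    {ψ : AddMonoid.End S} {toDualP : P₀ →+ (S →+ AddCircle (1 : ℚ))} (hP : IsDualPair 2 ψ toDualP)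
    (col : P₀ →ₗ[IwasawaAlgebra 2] IwasawaAlgebra 2) (hcol : Finite (LinearMap.ker col))
    (φ : W.selmerInfty κ →+ S) (hφ : ∀ s, φ ((W.conjSelmerInfty κ γ - 1) s) = ψ (φ s))
    (hφ₁ : ∀ s : W.selmerInfty κ, φ s = 0 ↔
      W.resOfLe 2 (inf_le_left : κ.kerSubgroup ⊓ decomp v₂ ≤ κ.kerSubgroup)
        (s : W.subgroupH1 2 κ.kerSubgroup) = 0)
    (ℓ₀ : I.H →ₗ[IwasawaAlgebra 2] P₀)
    (hrecG : ∀ g ∈ G, ∀ s : W.selmerInfty κ, toDualP (ℓ₀ g) (φ s) = 0)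
    (herl : ∃ g ∈ G, ∃ (u : (IwasawaAlgebra 2)ˣ) (M L' : IwasawaAlgebra 2) (r : ℚ_[2]),
      M ∉ IwasawaAlgebra.augIdealP 2 ∧ ‖r‖ = 1 ∧
        iwasawaToPowerSeries 2 L' = PowerSeries.C r * padicLFunction f (unitRoot W 2 : ℚ_[2]) ∧
        col (ℓ₀ g) = (u : IwasawaAlgebra 2) * M * L') :
    D.mu = 0 :=
  mu_eq_zero_of_localDualPair_finiteKer_locTwo_erl hgo h2 hΔ hf hγ D I G hG hP col hcol φ hφ
    (hφker_of_kernel_at_one_place_two hκ v₂ hv₂ φ hφ₁) ℓ₀ hrecG herl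

end PerDatum

/-- **F1μ⁺ `ZetaColemanMuInputsAtTwo` (child 23959) from the three typed inputs, curve by curve, with `φ = loc₂` given by
its kernel at ONE place above `2`**: for every `W` on the sign-free habitat «good ordinary at `2`, `ρ̄₂` onto» and every
Selmer dual datum `D` — a pinned `𝐇¹`, a set `G` of genuine `2`-adic Euler-system classes, a place `v₂ ∋ 2`, (L) a local
Coleman dual pair at `2` with injective `col` and `φ` whose kernel is the kernel of the restriction to `ker κ ⊓ D_{v₂}`
(F1-Col/F1-Dual), (R) reciprocity on `G` (F1-R), (E) the ERL shape (F1-ERLμ). Kernel implication; the supply is the OPEN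
content, nothing asserted. [cite: Kato2004Asterisque, Thm 12.6 (p. 222), Lemma 13.10 (p. 230), (14.9.3) (p. 240), Thm 16.6 (2) (p. 271), Prop 17.11 (p. 277), §17.13 (pp. 279–280)]
[cite: GreenbergLNM1716, §2 (p. 72) and Prop 2.1] -/
theorem zetaColemanMuInputsAtTwo_of_localDualPairs_locOne_erl
    (hsupply : ∀ (W : WeierstrassCurve ℚ) [W.IsElliptic] [W.IsGloballyMinimal]
      [ContinuousSMul ℤ_[2] (W.tateModule 2)] [Module.Free ℤ_[2] (W.tateModule 2)]
      [Module.Finite ℤ_[2] (W.tateModule 2)] {N : ℕ} [NeZero N] (f : CuspForm (Gamma0 N) 2)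
      (κ : ZpExtension ℚ 2) (γ : absoluteGaloisGroup ℚ) (hκ : κ.IsCyclotomic),
      IsOrdinaryAt W 2 → W.HasSurjectiveModNGaloisRep 2 →
      κ.IsTopGenerator γ → IsCyclotomicVariable 2 γ → IsNewformOf W f →
      ∀ (D : W.SelmerDualData κ γ),
        ∃ (I : IwasawaH1Data W 2 κ γ) (G : Set I.H)
          (v₂ : HeightOneSpectrum (𝓞 ℚ)) (_ : ((2 : ℕ) : 𝓞 ℚ) ∈ v₂.asIdeal)
          (P₀ : Type) (_ : AddCommGroup P₀) (_ : Module (IwasawaAlgebra 2) P₀)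
          (S : Type) (_ : AddCommGroup S) (ψ : AddMonoid.End S) (toDualP : P₀ →+ (S →+ AddCircle (1 : ℚ)))
          (col : P₀ →ₗ[IwasawaAlgebra 2] IwasawaAlgebra 2) (φ : W.selmerInfty κ →+ S)
          (ℓ₀ : I.H →ₗ[IwasawaAlgebra 2] P₀),
          (∀ g ∈ G, IsEulerSystemClassTwo W hκ I g) ∧
          IsDualPair 2 ψ toDualP ∧ Function.Injective col ∧
          (∀ s, φ ((W.conjSelmerInfty κ γ - 1) s) = ψ (φ s)) ∧
          (∀ s : W.selmerInfty κ, φ s = 0 ↔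
            W.resOfLe 2 (inf_le_left : κ.kerSubgroup ⊓ decomp v₂ ≤ κ.kerSubgroup)
              (s : W.subgroupH1 2 κ.kerSubgroup) = 0) ∧
          (∀ g ∈ G, ∀ s : W.selmerInfty κ, toDualP (ℓ₀ g) (φ s) = 0) ∧
          ∃ g ∈ G, ∃ (u : (IwasawaAlgebra 2)ˣ) (M L' : IwasawaAlgebra 2) (r : ℚ_[2]),
            M ∉ IwasawaAlgebra.augIdealP 2 ∧ ‖r‖ = 1 ∧
              iwasawaToPowerSeries 2 L' = PowerSeries.C r * padicLFunction f (unitRoot W 2 : ℚ_[2]) ∧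
              col (ℓ₀ g) = (u : IwasawaAlgebra 2) * M * L') :
    ZetaColemanMuInputsAtTwo := by
  intro W _ _ _ _ _ N _ f κ γ hκ hord h2 hγ hγ' hf D Y
  obtain ⟨I, G, v₂, hv₂, P₀, instP₀, instP₀', S, instS, ψ, toDualP, col, φ, ℓ₀, hG, hP, hcol, hφ, hφ₁,
    hrecG, herl⟩ := hsupply W f κ γ hκ hord h2 hγ hγ' hf D
  exact hasZetaColemanMuInputsAtTwo_of_localDualPair_locOne_erl D Y I G hG v₂ hv₂ hP col hcol φ hφ hφ₁ ℓ₀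
    hrecG herl

end Summit.BirchSwinnertonDyer.BirchSwinnertonDyer.Theorems.SteinbergFibreAtTwo

end
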